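import Summits.Ventures.DiscreteObjects.Hadamard.FixedSubmatrix23

/-!
# Hadamard matrices with a signed automorphism of odd prime order: tools for counting fixed rows (kernel)

Framing: lottery ticket; floor = certified bounds/negative ranges.

Cell pub-namedobj (venture DiscreteObjects), target (H), hadamard gen 9.  Support file for `PrimeOrder167` (an automorphism of
order 167 of H(668) is fixed-point-free):
* `card_le_of_pairwise_orthogonal`: at most `|K|` pairwise orthogonal nonzero rational vectors indexed by a finite type `K`
  (they are linearly independent over `ℚ`);
* `fixedRows_prod_const`, `fixedRows_moved_sum`, `fixedRows_split`: for two `π`-fixed rows `u ≠ u'` of a Hadamard matrix with a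
  signed automorphism `(π, κ, d, e)`, `κ^p = 1`, `p` an odd prime, the product `H u j · H u' j` is constant on every `κ`-class of
  moved columns, so `Σ_{κ j = j} H u j H u' j + p · Σ_{C} H u (rep C) H u' (rep C) = 0` for any choice of class representatives;
* `abs_sum_pm_le_card`, `pm_eq_one_of_sum_eq_card`, `pm_eq_neg_one_of_sum_eq_neg_card`: a sum of `±1` terms has absolute value at
  most the number of terms, with equality only if all terms are equal (rigidity).
Ours, not literature; no `sorry`.
-/

open Finset BigOperators Matrix

namespace Summit.Ventures.DiscreteObjects.Hadamard

open Literature.Combinatorics.Designs.GoethalsSeidel (IsHadamardMatrix)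


/-- at most `|K|` pairwise orthogonal nonzero rational vectors indexed by `K` (they are linearly independent) -/
lemma card_le_of_pairwise_orthogonal {m : ℕ} {K : Type*} [Fintype K] [DecidableEq K] (v : Fin m → K → ℚ)
    (hnz : ∀ i, ∃ k, v i k ≠ 0) (horth : ∀ i i', i ≠ i' → ∑ k, v i k * v i' k = 0) : m ≤ Fintype.card K := by
  have hli : LinearIndependent ℚ v := by
    rw [linearIndependent_iff']
    intro s g hg i hi
    -- evaluate the vanishing combination against v i
    have hk : ∀ k, ∑ i' ∈ s, g i' * v i' k = 0 := by
      intro k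
      have := congrFun hg k
      simpa [Finset.sum_apply, Pi.smul_apply, smul_eq_mul] using this
    have h1 : ∑ k, (∑ i' ∈ s, g i' * v i' k) * v i k = 0 := by
      simp [hk]
    have h2 : ∑ k, (∑ i' ∈ s, g i' * v i' k) * v i k = ∑ i' ∈ s, g i' * ∑ k, v i' k * v i k := by
      simp_rw [Finset.sum_mul, Finset.mul_sum, mul_assoc]
      rw [Finset.sum_comm]
    rw [h2] at h1
    have h3 : ∑ i' ∈ s, g i' * ∑ k, v i' k * v i k = g i * ∑ k, v i k * v i k := by
      rw [← Finset.add_sum_erase s _ hi]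
      have hz : ∑ i' ∈ s.erase i, g i' * ∑ k, v i' k * v i k = 0 := by
        apply Finset.sum_eq_zero
        intro i' hi'
        rw [horth i' i (Finset.ne_of_mem_erase hi'), mul_zero]
      rw [hz, add_zero]
    rw [h3] at h1
    have hpos : 0 < ∑ k, v i k * v i k := by
      obtain ⟨k₀, hk₀⟩ := hnz i
      calc (0 : ℚ) < v i k₀ * v i k₀ := mul_self_pos.mpr hk₀
        _ ≤ ∑ k, v i k * v i k := Finset.single_le_sum (f := fun k => v i k * v i k)
            (fun k _ => mul_self_nonneg (v i k)) (Finset.mem_univ k₀)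
    rcases mul_eq_zero.mp h1 with h | h
    · exact h
    · exact absurd h (ne_of_gt hpos)
  have := hli.fintype_card_le_finrank
  simpa [Module.finrank_fintype_fun_eq_card] using this


variable {ι : Type*} [Fintype ι] [DecidableEq ι]



omit [Fintype ι] [DecidableEq ι] in
/-- for two `π`-fixed rows (`p` odd, `κ^p = 1`) the row product `j ↦ H u j * H u' j` is constant along `κ`-orbits -/
lemma fixedRows_prod_const [Fintype ι] [DecidableEq ι] {H : Matrix ι ι ℤ} (hH : IsHadamardMatrix H)
    {π κ : Equiv.Perm ι} {d e : ι → ℤ} (haut : IsSignedAut H π κ d e) {p : ℕ} (hodd : Odd p) (hκ : κ ^ p = 1)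
    {u u' : ι} (hu : π u = u) (hu' : π u' = u') (y₀ : ι) (i : ℕ) :
    H u ((κ ^ i) y₀) * H u' ((κ ^ i) y₀) = H u y₀ * H u' y₀ := by
  have hsign := fixedRows_sign_eq_odd hH haut hodd hκ hu hu' y₀
  have h := fixedRows_prod_pow haut hu hu' i y₀
  rw [hsign, one_pow, one_mul] at h
  exact h

/-- the moved part of the product of two fixed rows is `p ×` the sum over class representatives -/
lemma fixedRows_moved_sum {H : Matrix ι ι ℤ} (hH : IsHadamardMatrix H)
    {π κ : Equiv.Perm ι} {d e : ι → ℤ} (haut : IsSignedAut H π κ d e) {p : ℕ} (hp : p.Prime) (hodd : Odd p)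
    (hκ : κ ^ p = 1) {u u' : ι} (hu : π u = u) (hu' : π u' = u')
    (rep : Finset ι → ι) (hrep : ∀ C ∈ blockClasses κ p, rep C ∈ C) :
    ∑ j ∈ univ.filter (fun j => κ j ≠ j), H u j * H u' j =
      (p : ℤ) * ∑ C ∈ blockClasses κ p, H u (rep C) * H u' (rep C) := by
  rw [← blockClasses_biUnion κ hp hκ, Finset.sum_biUnion (blockClasses_disjoint κ hp hκ), Finset.mul_sum]
  apply Finset.sum_congr rfl
  intro C hC
  obtain ⟨y₀, hy₀, rfl⟩ := Finset.mem_image.mp hC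
  have hy₀' := (Finset.mem_filter.mp hy₀).2
  have key : H u (rep (orbFin κ p y₀)) * H u' (rep (orbFin κ p y₀)) = H u y₀ * H u' y₀ := by
    obtain ⟨i, -, hi⟩ := Finset.mem_image.mp (hrep _ hC)
    have hi' : rep (orbFin κ p y₀) = (κ ^ i) y₀ := hi.symm
    rw [hi']
    exact fixedRows_prod_const hH haut hodd hκ hu hu' y₀ i
  rw [id, sum_orbFin_const κ hp hκ hy₀' (fun j => H u j * H u' j)
    (fun i => fixedRows_prod_const hH haut hodd hκ hu hu' y₀ i), key]

/-- orthogonality of two distinct fixed rows, split into the fixed columns and the classes: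
`Σ_{κ j = j} H u j H u' j + p · Σ_C H u (rep C) H u' (rep C) = 0` -/
lemma fixedRows_split {H : Matrix ι ι ℤ} (hH : IsHadamardMatrix H)
    {π κ : Equiv.Perm ι} {d e : ι → ℤ} (haut : IsSignedAut H π κ d e) {p : ℕ} (hp : p.Prime) (hodd : Odd p)
    (hκ : κ ^ p = 1) {u u' : ι} (hu : π u = u) (hu' : π u' = u') (huu' : u ≠ u')
    (rep : Finset ι → ι) (hrep : ∀ C ∈ blockClasses κ p, rep C ∈ C) :
    ∑ j ∈ univ.filter (fun j => κ j = j), H u j * H u' j +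
      (p : ℤ) * ∑ C ∈ blockClasses κ p, H u (rep C) * H u' (rep C) = 0 := by
  have htot : ∑ j, H u j * H u' j = 0 := hadamard_row_orth H hH huu'
  have hsplit : ∑ j, H u j * H u' j =
      ∑ j ∈ univ.filter (fun j => κ j = j), H u j * H u' j + ∑ j ∈ univ.filter (fun j => κ j ≠ j), H u j * H u' j := by
    rw [← Finset.sum_filter_add_sum_filter_not univ (fun j => κ j = j)]
  rw [hsplit, fixedRows_moved_sum hH haut hp hodd hκ hu hu' rep hrep] at htot
  exact htot

omit [Fintype ι] [DecidableEq ι] in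
/-- a sum of `±1` terms over `s` has absolute value at most `#s` -/
lemma abs_sum_pm_le_card (s : Finset ι) (g : ι → ℤ) (hg : ∀ j ∈ s, g j = 1 ∨ g j = -1) :
    |∑ j ∈ s, g j| ≤ s.card := by
  calc |∑ j ∈ s, g j| ≤ ∑ j ∈ s, |g j| := Finset.abs_sum_le_sum_abs _ _
    _ = ∑ j ∈ s, (1 : ℤ) := Finset.sum_congr rfl (fun j hj => by rcases hg j hj with h | h <;> simp [h])
    _ = s.card := by rw [Finset.sum_const, nsmul_eq_mul, mul_one]

omit [Fintype ι] [DecidableEq ι] in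
/-- rigidity: a sum of `±1` terms equal to `#s` forces every term to be `1` -/
lemma pm_eq_one_of_sum_eq_card (s : Finset ι) (g : ι → ℤ) (hg : ∀ j ∈ s, g j = 1 ∨ g j = -1)
    (h : ∑ j ∈ s, g j = s.card) : ∀ j ∈ s, g j = 1 := by
  have h0 : ∑ j ∈ s, (1 - g j) = 0 := by
    rw [Finset.sum_sub_distrib, Finset.sum_const, nsmul_eq_mul, mul_one, h]; ring
  have hnn : ∀ j ∈ s, 0 ≤ 1 - g j := fun j hj => by rcases hg j hj with h | h <;> simp [h]
  intro j hj
  have := (Finset.sum_eq_zero_iff_of_nonneg hnn).mp h0 j hj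
  linarith

omit [Fintype ι] [DecidableEq ι] in
/-- rigidity: a sum of `±1` terms equal to `-#s` forces every term to be `-1` -/
lemma pm_eq_neg_one_of_sum_eq_neg_card (s : Finset ι) (g : ι → ℤ) (hg : ∀ j ∈ s, g j = 1 ∨ g j = -1)
    (h : ∑ j ∈ s, g j = -s.card) : ∀ j ∈ s, g j = -1 := by
  have h' : ∑ j ∈ s, (-g j) = s.card := by rw [Finset.sum_neg_distrib, h]; ring
  have hg' : ∀ j ∈ s, -g j = 1 ∨ -g j = -1 := fun j hj => by rcases hg j hj with h | h <;> simp [h]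
  intro j hj
  have := pm_eq_one_of_sum_eq_card s (fun j => -g j) hg' h' j hj
  linarith

end Summit.Ventures.DiscreteObjects.Hadamard
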